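import Summits.HodgeConjecture.HodgeConjecture.Theorems.R90S6SatakeGraphPartner          -- ★ W3-a `satakeGraph_partner_exists` (p862301)
import Summits.HodgeConjecture.HodgeConjecture.Theorems.R90S6SatakeGraphPartnerUnique    -- ★ W3-b `satakeGraph_partner_unique` (p862296)
import HarnessLib

/-!
# R90 · S6 «Ch. 14.1–14.5 stable TF» — WAVE 4 (a)(b): the SATAKE-GRAPH PARTNER AS A `ℂ`-ALGEBRA HOMOMORPHISM
# `b_w : φ ↦ φ^H`, `ℋ(U(J₀,3)(E_w), K₀) →ₐ[ℂ] ℋ(U(J₀,2)(E_w), K₀)` (`Theorems/R90S6SatakeGraphPartnerHom.lean`)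

Cell `hodgecm-mathlib`, crux H413 (`stmt-HodgeConjecture-24833`), route `HCCMUnconditional`; programme R90-TF, section S6 (base `R90-C14`, dealer
R90-C14-plan (g0)), seat R90-C14-p03 (g0); cards W4-a∕b (DEAL 2026-09-04T21:56:50Z ∕ 21:58:07Z), sheet
`R90/R90-C14-plan/g0/S6_wave4_targets.v1.R90-C14-plan-g0.lean` b3282a7e4a073a0b (statements token-identical, ns `.Wave4` dropped; one extra law
`satakeGraphPartner_algebraMap` = the `commutes'` field).  Lane `--kind definition --supports stmt-HodgeConjecture-24833 --as helper`; two definitions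
+ their laws; no instance, no notation, no named fact, no `sorry`; imports = ★ W3-a `Theorems.R90S6SatakeGraphPartner` (p862301) + ★ W3-b
`Theorems.R90S6SatakeGraphPartnerUnique` (p862296) + HarnessLib (Theorems → Theorems; no `Cruxes` import).

THE PRINT [Rogawski1990, §4.5 p. 55; §4.9 Prop. 4.9.1 (b) p. 55]: the map `f ↦ ξ̂_H(f)`, `ℋ(G_w, K_w) → ℋ(H_w, K_{H,w})`, characterised by
`ξ̂_H(f)^∧(z) = f^∧(−z)` — the map `b : ℋ_G → ℋ_H` of the Hecke-algebra fundamental lemma, whose graph is the predicate `R90.S6.SatakeGraph` of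
`Cruxes/H413/Lines/R90_S6_FloorE1D.lean` § (E1-c); it is an algebra homomorphism because the Satake transforms ∕ eigencharacters are
([CartierCorvallis1979, §IV Thm. 4.1, Cor. 4.2]).  WHY ON PATH: the two-place-frame Hecke variation (S6 ED. 2b) varies a matched pair functorially,
`φ ↦ (φ, b_w φ)`, unit ↦ unit.  CONTENT: everything is ★ W3-a (existence) + ★ W3-b (uniqueness) + the hom laws of the two eigencharacters
`unitaryHeckeEigencharacterAdic … : _ →ₐ[ℂ] ℂ` — both sides of each law lie on the graph, hence agree; no Satake internals are reopened.
Elaboration note: the carrier is heavy, so the proofs feed the hom laws through `Eq.trans` ∕ the underlying `RingHom` ∕ `LinearMap` (a bare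
`rw [map_add]` or `(map_mul _ _ _).trans` runs class synthesis with unknown carriers and times out) — mathematics unchanged.
HONEST LABEL: local spherical Hecke-algebra bookkeeping; proves no printed global statement, discharges no citation.  HC_CM is proved only modulo
the 7 printed citations (2 remaining named inputs: hLiu418 = stmt-HodgeConjecture-24832, h413 = stmt-HodgeConjecture-24833) until rung 0 closes.

## References
* [Rogawski1990] J. D. Rogawski, *Automorphic Representations of Unitary Groups in Three Variables*, Ann. of Math. Stud. 123 (1990), §4.5 p. 55, §4.9 p. 55.
* [CartierCorvallis1979] P. Cartier, *Representations of 𝔭-adic groups: a survey*, PSPM 33.1 (1979), §IV Thm. 4.1, Cor. 4.2.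
-/
set_option autoImplicit false
-- the mandated namespace repeats the single-problem summit's segment (`HodgeConjecture.HodgeConjecture`)
set_option linter.dupNamespace false

noncomputable section

open NumberField IsDedekindDomain
open Literature.NumberTheory.Automorphic Literature.NumberTheory.Automorphic.HermitianLattice Literature.NumberTheory.Automorphic.UnitaryGroup

namespace Summit.HodgeConjecture.HodgeConjecture.R90.S6

variable {F E : Type} [Field F] [NumberField F] [Field E] [NumberField E] [Algebra F E] [Algebra.IsQuadraticExtension F E]
  (c : E ≃ₐ[F] E) (hc1 : c ≠ 1) (v : HeightOneSpectrum (𝓞 F)) (w : PlacesOver E v) (hw : c • w.1 = w.1)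
  (hv : Algebra.IsUnramifiedIn (𝓞 E) v.asIdeal)

/-- **The Satake-graph partner `φ ↦ φ^H`** [Rogawski1990, §4.5 p. 55 `ξ̂_H`]: for `φ ∈ ℋ(U(J₀,3)(E_w), K₀)`, THE element
`φ^H ∈ ℋ(U(J₀,2)(E_w), K₀)` with `λ^{(2)}_{(z,1)}(φ^H) = λ^{(3)}_{(−z,1,1)}(φ)` for all `z ∈ ℂˣ` (exists by ★ `satakeGraph_partner_exists`,
unique by ★ `satakeGraph_partner_unique`; chosen with `Classical.choose`). [cite: Rogawski1990, §4.5 p. 55] -/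
noncomputable def satakeGraphPartner
    (φ : heckeAlgebra ℂ ↥(unitaryGroupOfForm (galAdicCompletionMap (L := E) c hw) ((StdForm.antidiagonal 3).over (w.1.adicCompletion E)))
      (unitaryInt (galAdicCompletionMap (L := E) c hw) ((StdForm.antidiagonal 3).over (w.1.adicCompletion E)))) :
    heckeAlgebra ℂ ↥(unitaryGroupOfForm (galAdicCompletionMap (L := E) c hw) ((StdForm.antidiagonal 2).over (w.1.adicCompletion E)))
      (unitaryInt (galAdicCompletionMap (L := E) c hw) ((StdForm.antidiagonal 2).over (w.1.adicCompletion E))) :=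
  (satakeGraph_partner_exists c hc1 v w hw hv φ).choose

/-- **The graph relation of `φ^H`**: `λ^{(2)}_{(z,1)}(φ^H) = λ^{(3)}_{(−z,1,1)}(φ)` for every `z ∈ ℂˣ` (print's `ξ̂_H(f)^∧(z) = f^∧(−z)`).
[cite: Rogawski1990, §4.5 p. 55] -/
theorem satakeGraphPartner_graph
    (φ : heckeAlgebra ℂ ↥(unitaryGroupOfForm (galAdicCompletionMap (L := E) c hw) ((StdForm.antidiagonal 3).over (w.1.adicCompletion E)))
      (unitaryInt (galAdicCompletionMap (L := E) c hw) ((StdForm.antidiagonal 3).over (w.1.adicCompletion E)))) (z : ℂˣ) :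
    unitaryHeckeEigencharacterAdic c hc1 v w hw hv ![z, 1] (satakeGraphPartner c hc1 v w hw hv φ) =
      unitaryHeckeEigencharacterAdic c hc1 v w hw hv ![-z, 1, 1] φ :=
  (satakeGraph_partner_exists c hc1 v w hw hv φ).choose_spec z

/-- **Characterisation**: any `φH` in Satake-graph position with `φ` IS `φ^H` (★ `satakeGraph_partner_unique`).
[cite: Rogawski1990, §4.5 p. 55] [cite: CartierCorvallis1979, §IV Cor. 4.2] -/
theorem eq_satakeGraphPartner_of_graph
    (φ : heckeAlgebra ℂ ↥(unitaryGroupOfForm (galAdicCompletionMap (L := E) c hw) ((StdForm.antidiagonal 3).over (w.1.adicCompletion E)))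
      (unitaryInt (galAdicCompletionMap (L := E) c hw) ((StdForm.antidiagonal 3).over (w.1.adicCompletion E))))
    (φH : heckeAlgebra ℂ ↥(unitaryGroupOfForm (galAdicCompletionMap (L := E) c hw) ((StdForm.antidiagonal 2).over (w.1.adicCompletion E)))
      (unitaryInt (galAdicCompletionMap (L := E) c hw) ((StdForm.antidiagonal 2).over (w.1.adicCompletion E))))
    (h : ∀ z : ℂˣ, unitaryHeckeEigencharacterAdic c hc1 v w hw hv ![z, 1] φH =
      unitaryHeckeEigencharacterAdic c hc1 v w hw hv ![-z, 1, 1] φ) :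
    φH = satakeGraphPartner c hc1 v w hw hv φ :=
  satakeGraph_partner_unique c hc1 v w hw hv φH _ fun z => (h z).trans (satakeGraphPartner_graph c hc1 v w hw hv φ z).symm

/-- `1^H = 1` (both sides have eigenvalues `1`). [cite: Rogawski1990, §4.5 p. 55] -/
theorem satakeGraphPartner_one : satakeGraphPartner c hc1 v w hw hv 1 = 1 :=
  (eq_satakeGraphPartner_of_graph c hc1 v w hw hv 1 1 fun _ => Eq.trans (map_one _) (Eq.symm (map_one _))).symm

/-- `0^H = 0` (both sides have eigenvalues `0`). [cite: Rogawski1990, §4.5 p. 55] -/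
theorem satakeGraphPartner_zero : satakeGraphPartner c hc1 v w hw hv 0 = 0 :=
  (eq_satakeGraphPartner_of_graph c hc1 v w hw hv 0 0 fun _ => Eq.trans (map_zero _) (Eq.symm (map_zero _))).symm

/-- `(φ ψ)^H = φ^H ψ^H` (the eigencharacters are multiplicative). [cite: Rogawski1990, §4.5 p. 55] -/
theorem satakeGraphPartner_mul
    (φ ψ : heckeAlgebra ℂ ↥(unitaryGroupOfForm (galAdicCompletionMap (L := E) c hw) ((StdForm.antidiagonal 3).over (w.1.adicCompletion E)))
      (unitaryInt (galAdicCompletionMap (L := E) c hw) ((StdForm.antidiagonal 3).over (w.1.adicCompletion E)))) :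
    satakeGraphPartner c hc1 v w hw hv (φ * ψ) = satakeGraphPartner c hc1 v w hw hv φ * satakeGraphPartner c hc1 v w hw hv ψ :=
  -- (hygiene: partner-side element left to unification, hom laws fed through `Eq.trans` — see the module docstring)
  (eq_satakeGraphPartner_of_graph c hc1 v w hw hv (φ * ψ) _
    fun z => Eq.trans (map_mul _ _ _) (Eq.trans
      (congrArg₂ (· * ·) (satakeGraphPartner_graph c hc1 v w hw hv φ z) (satakeGraphPartner_graph c hc1 v w hw hv ψ z))
      (Eq.symm (map_mul _ _ _)))).symm

/-- `(φ + ψ)^H = φ^H + ψ^H` (the eigencharacters are additive). [cite: Rogawski1990, §4.5 p. 55] -/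
theorem satakeGraphPartner_add
    (φ ψ : heckeAlgebra ℂ ↥(unitaryGroupOfForm (galAdicCompletionMap (L := E) c hw) ((StdForm.antidiagonal 3).over (w.1.adicCompletion E)))
      (unitaryInt (galAdicCompletionMap (L := E) c hw) ((StdForm.antidiagonal 3).over (w.1.adicCompletion E)))) :
    satakeGraphPartner c hc1 v w hw hv (φ + ψ) = satakeGraphPartner c hc1 v w hw hv φ + satakeGraphPartner c hc1 v w hw hv ψ := by
  refine (eq_satakeGraphPartner_of_graph c hc1 v w hw hv (φ + ψ) _ fun z => ?_).symm
  -- additivity through the `RingHom` underlying `λ_β` (the generic `map_add` would search `AddHomClass` over this heavy carrier)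
  have h₂ := (unitaryHeckeEigencharacterAdic c hc1 v w hw hv ![z, 1]).toRingHom.map_add
    (satakeGraphPartner c hc1 v w hw hv φ) (satakeGraphPartner c hc1 v w hw hv ψ)
  have h₃ := (unitaryHeckeEigencharacterAdic c hc1 v w hw hv ![-z, 1, 1]).toRingHom.map_add φ ψ
  exact h₂.trans ((congrArg₂ (· + ·) (satakeGraphPartner_graph c hc1 v w hw hv φ z) (satakeGraphPartner_graph c hc1 v w hw hv ψ z)).trans
    h₃.symm)

/-- `(r • φ)^H = r • φ^H` for `r ∈ ℂ` (the eigencharacters are `ℂ`-linear). [cite: Rogawski1990, §4.5 p. 55] -/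
theorem satakeGraphPartner_smul (r : ℂ)
    (φ : heckeAlgebra ℂ ↥(unitaryGroupOfForm (galAdicCompletionMap (L := E) c hw) ((StdForm.antidiagonal 3).over (w.1.adicCompletion E)))
      (unitaryInt (galAdicCompletionMap (L := E) c hw) ((StdForm.antidiagonal 3).over (w.1.adicCompletion E)))) :
    satakeGraphPartner c hc1 v w hw hv (r • φ) = r • satakeGraphPartner c hc1 v w hw hv φ := by
  refine (eq_satakeGraphPartner_of_graph c hc1 v w hw hv (r • φ) _ fun z => ?_).symm
  -- linearity through the `LinearMap` underlying `λ_β` (the generic `map_smul` would search `MulActionSemiHomClass` over this carrier)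
  have h₂ := (unitaryHeckeEigencharacterAdic c hc1 v w hw hv ![z, 1]).toLinearMap.map_smul r
    (satakeGraphPartner c hc1 v w hw hv φ)
  have h₃ := (unitaryHeckeEigencharacterAdic c hc1 v w hw hv ![-z, 1, 1]).toLinearMap.map_smul r φ
  exact h₂.trans ((congrArg (r • ·) (satakeGraphPartner_graph c hc1 v w hw hv φ z)).trans h₃.symm)

/-- `(r · 1)^H = r · 1` for `r ∈ ℂ`: the partner map commutes with the structure maps `ℂ → ℋ` (both eigencharacters send `r · 1` to `r`);
this is the `commutes'` field of the packaging below. [cite: Rogawski1990, §4.5 p. 55] -/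
theorem satakeGraphPartner_algebraMap (r : ℂ) :
    satakeGraphPartner c hc1 v w hw hv (algebraMap ℂ _ r) = algebraMap ℂ _ r :=
  (eq_satakeGraphPartner_of_graph c hc1 v w hw hv (algebraMap ℂ _ r) (algebraMap ℂ _ r) fun _ =>
    Eq.trans (AlgHom.commutes _ _) (Eq.symm (AlgHom.commutes _ _))).symm

/-- **The Satake-graph partner as a `ℂ`-algebra homomorphism `b : ℋ(U(J₀,3)(E_w), K₀) →ₐ[ℂ] ℋ(U(J₀,2)(E_w), K₀)`** — print's `f ↦ ξ̂_H(f)`,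
the map `b` of [Rogawski1990, §4.9 Prop. 4.9.1 (b)]; its underlying function is `satakeGraphPartner`. [cite: Rogawski1990, §4.5 p. 55; §4.9 p. 55] -/
noncomputable def satakeGraphPartnerAlgHom :
    heckeAlgebra ℂ ↥(unitaryGroupOfForm (galAdicCompletionMap (L := E) c hw) ((StdForm.antidiagonal 3).over (w.1.adicCompletion E)))
        (unitaryInt (galAdicCompletionMap (L := E) c hw) ((StdForm.antidiagonal 3).over (w.1.adicCompletion E))) →ₐ[ℂ]
      heckeAlgebra ℂ ↥(unitaryGroupOfForm (galAdicCompletionMap (L := E) c hw) ((StdForm.antidiagonal 2).over (w.1.adicCompletion E)))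
        (unitaryInt (galAdicCompletionMap (L := E) c hw) ((StdForm.antidiagonal 2).over (w.1.adicCompletion E))) where
  toFun := satakeGraphPartner c hc1 v w hw hv
  map_one' := satakeGraphPartner_one c hc1 v w hw hv
  map_mul' := satakeGraphPartner_mul c hc1 v w hw hv
  map_zero' := satakeGraphPartner_zero c hc1 v w hw hv
  map_add' := satakeGraphPartner_add c hc1 v w hw hv
  commutes' := satakeGraphPartner_algebraMap c hc1 v w hw hv

/-- `b φ = φ^H` (definitional). [cite: Rogawski1990, §4.5 p. 55] -/
theorem satakeGraphPartnerAlgHom_apply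
    (φ : heckeAlgebra ℂ ↥(unitaryGroupOfForm (galAdicCompletionMap (L := E) c hw) ((StdForm.antidiagonal 3).over (w.1.adicCompletion E)))
      (unitaryInt (galAdicCompletionMap (L := E) c hw) ((StdForm.antidiagonal 3).over (w.1.adicCompletion E)))) :
    satakeGraphPartnerAlgHom c hc1 v w hw hv φ = satakeGraphPartner c hc1 v w hw hv φ := rfl

/-- **The graph law for the hom** (the form the (E1-c) `SatakeGraph` consumers read): `λ^{(2)}_{(z,1)}(b φ) = λ^{(3)}_{(−z,1,1)}(φ)` for
every `z ∈ ℂˣ` (print's `ξ̂_H(f)^∧(z) = f^∧(−z)`). [cite: Rogawski1990, §4.5 p. 55; §4.9 p. 55] -/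
theorem graph_satakeGraphPartnerAlgHom
    (φ : heckeAlgebra ℂ ↥(unitaryGroupOfForm (galAdicCompletionMap (L := E) c hw) ((StdForm.antidiagonal 3).over (w.1.adicCompletion E)))
      (unitaryInt (galAdicCompletionMap (L := E) c hw) ((StdForm.antidiagonal 3).over (w.1.adicCompletion E)))) (z : ℂˣ) :
    unitaryHeckeEigencharacterAdic c hc1 v w hw hv ![z, 1] (satakeGraphPartnerAlgHom c hc1 v w hw hv φ) =
      unitaryHeckeEigencharacterAdic c hc1 v w hw hv ![-z, 1, 1] φ :=
  satakeGraphPartner_graph c hc1 v w hw hv φ z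

end Summit.HodgeConjecture.HodgeConjecture.R90.S6

end
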